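import Summits.Ventures.CertifiedManyBodySolver.Rows.LiebBlockReflectionIneq
import Summits.Ventures.CertifiedManyBodySolver.Rows.AndersonLiebCoordinates
import Summits.Ventures.CertifiedQuantumChemistry.Rows.SpinSectors
import Literature.MathematicalPhysics.QuantumLattice.HubbardNNNHoppingBootstrapCertificate
import Literature.MathematicalPhysics.QuantumLattice.HubbardSzSectorMonotone
import Literature.MathematicalPhysics.QuantumLattice.HubbardBoxSectorEnergyBounds
import Literature.MathematicalPhysics.QuantumLattice.SectorVariationalBounds

/-!
# The half-filled block lemma for the Anderson cluster rows

Support file for the certified many-body solver (venture `CertifiedManyBodySolver`, lane A rows):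
first certified bounds; not a superconductivity verdict; every number certified or labelled float.

The `anderson_psd_*` claim nodes of the lane-A certificates assert
`andersonCluster Λ' t U w v - q·1 ⪰ 0` on the whole `4^{|Λ'|}`-dimensional Fock space of the
cluster. This file proves that for `U ≥ 0` and site weights `v ≥ 0` it suffices to certify ONE
block:

* `posSemidef_andersonCluster_sub_smul_of_halfFilled_block` — the half-filled block `N = |Λ'|`
  (spin-reflection positivity, Lieb 1989 Theorem 2: the global ground state of the particle–hole
  symmetric repulsive cluster sits at half filling; abstract engine
  `re_hsInner_liebOp_ge_of_block`);
* `posSemidef_andersonCluster_sub_smul_of_sector_block` — one `(N↑, N↓) = (a, b)` block with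
  `a + b = |Λ'|`, `|a - b| ≤ 1` (adding the `SU(2)` ladder
  `sectorGroundEnergy_le_groundEnergy_of_su2` of the quantum-chemistry rows).

Energy forms (`…_of_le_groundEnergy`, `…_of_le_sectorGroundEnergy`) and the generic sector
bookkeeping (`le_groundEnergy_of_forall_isInSector`, `le_sectorGroundEnergy_of_toBlock_posSemidef`)
are stated for reuse. At `|Λ'| = 17` the block has dimension `C(34,17) ≈ 2.3·10⁹ / C(17,9)·C(17,8)
≈ 5.9·10⁸` against `4¹⁷ ≈ 1.7·10¹⁰` (÷7.4 resp. ÷29).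

References: E. H. Lieb, *Two theorems on the Hubbard model*, Phys. Rev. Lett. **62** (1989) 1201,
Theorems 1–2; G.-S. Tian, Phys. Rev. B **58** (1998) 7612.
-/

namespace Summit.Ventures.CertifiedManyBodySolver.Rows

open Matrix Finset Literature.MathematicalPhysics.QuantumLattice
  Literature.MathematicalPhysics.QuantumLattice.AndersonCluster Literature.Probability.LatticeModels
  Literature.MathematicalPhysics.QuantumChemistry
open scoped ComplexOrder

/-! ### Sector bookkeeping -/

section Generic

variable {Λ : Type*} [LinearOrder Λ] [Fintype Λ]

/-- **A bound valid on every `(N↑, N↓)` sector of particle number `N` bounds `E₀(N)`** for a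
Hermitian operator conserving `(N↑, N↓)`: a ground state of the `N`-particle space has a nonzero
component in some sector `(a, N - a)`, itself a ground state (the tree's
`groundEnergyAt_ge_of_forall_isInSector` for a general `H`).
[cite: LiebPRL1989, proof of Theorem 1] -/
theorem le_groundEnergy_of_forall_isInSector (H : Matrix (Finset (Orb Λ)) (Finset (Orb Λ)) ℂ)
    (hH : H.IsHermitian) (hpres : PreservesSectors H) {N : ℕ} (hN : N ≤ 2 * Fintype.card Λ)
    {c : ℝ} (h : ∀ a b : ℕ, a + b = N → ∀ φ : Fock (Orb Λ), IsInSector a b φ →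
      c * (star φ ⬝ᵥ φ).re ≤ (star φ ⬝ᵥ (H *ᵥ φ)).re) :
    c ≤ groundEnergy H N := by
  classical
  obtain ⟨ψ, hψN, hψ1, hHψ⟩ :=
    ThermodynamicLimit.exists_unit_groundState_of_preservesSectors H hH hpres hN
  have hψ0 : ψ ≠ 0 := by
    intro h0
    rw [h0, star_zero, zero_dotProduct] at hψ1
    exact zero_ne_one hψ1
  obtain ⟨a, ha, hva⟩ : ∃ a ∈ range (N + 1), sectorProj a (N - a) ψ ≠ 0 := by
    by_contra hall
    push Not at hall
    exact hψ0 ((sum_sectorProj_eq hψN).symm.trans (Finset.sum_eq_zero hall))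
  have haN : a + (N - a) = N := by
    rw [Finset.mem_range] at ha
    omega
  set φ := sectorProj a (N - a) ψ with hφ
  have hHφ : H *ᵥ φ = ((groundEnergy H N : ℝ) : ℂ) • φ := by
    rw [hφ, hpres.mulVec_sectorProj, hHψ, sectorProj_smul]
  have hE : (star φ ⬝ᵥ (H *ᵥ φ)).re = groundEnergy H N * (star φ ⬝ᵥ φ).re := by
    rw [hHφ, dotProduct_smul, smul_eq_mul, Complex.re_ofReal_mul]
  have hpos : 0 < (star φ ⬝ᵥ φ).re :=
    (Complex.pos_iff.mp (dotProduct_star_self_pos_iff.2 hva)).1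
  have hb := h a (N - a) haN φ (isInSector_sectorProj _ _ _)
  rw [hE] at hb
  exact le_of_mul_le_mul_right hb hpos

/-- In Lieb's coordinates a coefficient matrix supported on `a`-particle rows and `b`-particle
(down-hole) columns is a vector of the sector `(N↑, N↓) = (a, |Λ| - b)` (Tian's Step 1, re-proved:
the tree's copy is private). [cite: LiebPRL1989, proof of Theorem 2] -/
theorem isInSector_toFock_of_supp (A : Finset Λ) {a b : ℕ} {M : Matrix (Finset Λ) (Finset Λ) ℂ}
    (hM : ∀ α β, M α β ≠ 0 → α.card = a ∧ β.card = b) :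
    IsInSector a (Fintype.card Λ - b) (LiebTwo.toFock A M) := by
  intro s hs
  simp only [LiebTwo.toFock]
  by_contra h
  have hM' : M (upPart s) (downPart s)ᶜ ≠ 0 := fun h0 => h (by rw [h0, mul_zero])
  obtain ⟨h1, h2⟩ := hM _ _ hM'
  rw [Finset.card_compl] at h2
  have := Finset.card_le_univ (downPart s)
  exact hs ⟨h1, by omega⟩

/-- Conversely the coefficient matrix of a vector of the sector `(p, q)` is supported on
`p`-particle rows and `(|Λ| - q)`-particle columns. [cite: LiebPRL1989, proof of Theorem 2] -/
theorem supp_ofFock_of_isInSector (A : Finset Λ) {p q : ℕ} {ψ : Fock (Orb Λ)}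
    (hψ : IsInSector p q ψ) :
    ∀ α β, LiebTwo.ofFock A ψ α β ≠ 0 → α.card = p ∧ β.card = Fintype.card Λ - q := by
  intro α β h
  simp only [LiebTwo.ofFock] at h
  have hψ' : ψ (pairSet α βᶜ) ≠ 0 := fun h0 => h (by rw [h0, mul_zero])
  have hsec : (upPart (pairSet α βᶜ)).card = p ∧ (downPart (pairSet α βᶜ)).card = q := by
    by_contra hc
    exact hψ' (hψ _ hc)
  rw [upPart_pairSet, downPart_pairSet, Finset.card_compl] at hsec
  have := Finset.card_le_univ β
  omega

omit [LinearOrder Λ] in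
/-- A coefficient matrix with rows of an impossible particle number `a > |Λ|` vanishes.
[folklore] -/
theorem eq_zero_of_supp_card_gt {a b : ℕ} (ha : Fintype.card Λ < a)
    {Z : Matrix (Finset Λ) (Finset Λ) ℂ}
    (hZ : ∀ α β, Z α β ≠ 0 → α.card = a ∧ β.card = b) : Z = 0 := by
  ext α β
  by_contra h
  have h1 := (hZ α β h).1
  have := Finset.card_le_univ α
  omega

/-- **A `PosSemidef` sector block bounds the sector energy from below**: if the compression of `H`
to the occupation configurations of the sector `(N↑, N↓) = (a, b)` (`a, b ≤ |Λ|`) satisfies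
`B - q·1 ⪰ 0`, then `q ≤ sectorGroundEnergy H a b` — the form in which a finite certificate is
checked (cf. `le_groundEnergy_of_sectorBlock_posSemidef` for the `N`-block). [folklore] -/
theorem le_sectorGroundEnergy_of_toBlock_posSemidef {H : Matrix (Finset (Orb Λ)) (Finset (Orb Λ)) ℂ}
    (hH : H.IsHermitian) (hpres : PreservesSectors H) {a b : ℕ} (ha : a ≤ Fintype.card Λ)
    (hb : b ≤ Fintype.card Λ) {q : ℝ}
    (hblk : (H.toBlock (fun s => (upPart s).card = a ∧ (downPart s).card = b)
        (fun s => (upPart s).card = a ∧ (downPart s).card = b) - (q : ℂ) • 1).PosSemidef) :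
    q ≤ sectorGroundEnergy H a b := by
  classical
  obtain ⟨⟨χ, hχ, hχ0, hHχ⟩, -⟩ := upDownSector_groundState_of_preservesSectors hH hpres ha hb
  rw [sectorGroundEnergy_def]
  set E := H.minEnergyOn (szSector (a + b) (((a : ℝ) - b) / 2)) with hE
  have hsupp : ∀ s, ¬((upPart s).card = a ∧ (downPart s).card = b) → χ s = 0 := hχ
  have h0 := hblk.dotProduct_mulVec_nonneg
    (fun s : {s // (upPart s).card = a ∧ (downPart s).card = b} => χ s.1)
  rw [sub_mulVec, dotProduct_sub, Matrix.smul_mulVec, one_mulVec, dotProduct_smul,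
    star_restrict_dotProduct_toBlock_mulVec (fun s => (upPart s).card = a ∧ (downPart s).card = b)
      H χ hsupp,
    star_restrict_dotProduct_restrict (fun s => (upPart s).card = a ∧ (downPart s).card = b)
      χ χ hsupp, hHχ, dotProduct_smul] at h0
  have hpos : 0 < (star χ ⬝ᵥ χ).re :=
    (Complex.pos_iff.mp (dotProduct_star_self_pos_iff.2 hχ0)).1
  obtain ⟨hre, -⟩ := Complex.nonneg_iff.mp h0
  simp only [Complex.sub_re, smul_eq_mul, Complex.re_ofReal_mul] at hre
  nlinarith

end Generic

/-! ### The half-filled block lemma for the Anderson cluster operator -/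

section Cluster

variable {d : ℕ} (Λ' : Finset (Site d))

/-- **Spin-reflection positivity, one sector**: if `q ≤ E₀(h; N = |Λ'|)` (the half-filled ground
energy of the Anderson cluster operator, `U ≥ 0`, `v ≥ 0`), then `q ‖φ‖² ≤ Re ⟨φ, h φ⟩` for every
`φ` of EVERY sector `(N↑, N↓) = (a, b)`, at any filling. In Lieb's coordinates `φ = ψ_M` with `M`
an `a × (|Λ'| - b)` coefficient matrix and `⟨ψ_M, h ψ_M⟩ = ⟨M, 𝓛 M⟩ + c ⟨M, M⟩`
(`andersonCluster_mulVec_toFock`); the square blocks of `𝓛` are half-filled sectors, bounded by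
`q - c` by hypothesis, and `re_hsInner_liebOp_ge_of_block` (Lieb's inequality
`E(W) ≥ ½E(|W|) + ½E(|Wᴴ|)`, Tian's off-diagonal-block form) transfers the bound to the
rectangular block. [cite: LiebPRL1989, proof of Theorem 2, ineq. (6)] -/
theorem andersonCluster_sector_bound (t : ℝ) {U : ℝ} (hU : 0 ≤ U) (w : Site d → Fin d → ℝ)
    {v : Site d → ℝ} (hv : ∀ x, 0 ≤ v x) {q : ℝ}
    (hq : q ≤ groundEnergy (andersonCluster Λ' t U w v) (Fintype.card (PolySite Λ')))
    {a b : ℕ} (φ : Fock (Orb (PolySite Λ'))) (hφ : IsInSector a b φ) :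
    q * (star φ ⬝ᵥ φ).re ≤ (star φ ⬝ᵥ (andersonCluster Λ' t U w v *ᵥ φ)).re := by
  classical
  set A := evenSub Λ' with hA
  set c := liebShift Λ' U v with hc
  have key : ∀ M : Matrix (Finset (PolySite Λ')) (Finset (PolySite Λ')) ℂ,
      (star (LiebTwo.toFock A M) ⬝ᵥ (andersonCluster Λ' t U w v *ᵥ LiebTwo.toFock A M)).re =
        (hsInner M (liebOp (liebHop Λ' t w) (liebOcc Λ' v) (-U) M)).re + c * (hsInner M M).re := by
    intro M
    rw [andersonCluster_mulVec_toFock Λ' t U w hv M, LiebTwo.star_toFock_dotProduct_toFock,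
      hsInner_add_right, hsInner_smul_right, Complex.add_re, Complex.re_ofReal_mul]
  have nrm : ∀ M : Matrix (Finset (PolySite Λ')) (Finset (PolySite Λ')) ℂ,
      star (LiebTwo.toFock A M) ⬝ᵥ LiebTwo.toFock A M = hsInner M M := fun M =>
    LiebTwo.star_toFock_dotProduct_toFock A M M
  -- the square (half-filled) blocks
  have sq : ∀ a' : ℕ, ∀ Z : Matrix (Finset (PolySite Λ')) (Finset (PolySite Λ')) ℂ,
      (∀ α β, Z α β ≠ 0 → α.card = a' ∧ β.card = a') →
      (q - c) * (hsInner Z Z).re ≤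
        (hsInner Z (liebOp (liebHop Λ' t w) (liebOcc Λ' v) (-U) Z)).re := by
    intro a' Z hZ
    by_cases ha' : a' ≤ Fintype.card (PolySite Λ')
    · have hsec := isInSector_toFock_of_supp A hZ
      have hNp : IsNParticle (Fintype.card (PolySite Λ')) (LiebTwo.toFock A Z) := by
        have h := hsec.isNParticle
        rwa [Nat.add_sub_cancel' ha'] at h
      have hge := re_dotProduct_mulVec_ge_groundEnergy (andersonCluster Λ' t U w v) hNp
      rw [key, nrm] at hge
      have hnn : 0 ≤ (hsInner Z Z).re := hsInner_self_re_nonneg Z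
      have hqn := mul_le_mul_of_nonneg_right hq hnn
      rw [sub_mul]
      linarith
    · rw [eq_zero_of_supp_card_gt (lt_of_not_ge ha') hZ]
      simp [hsInner, liebOp]
  -- the rectangular block of the sector `(a, b)`
  set M := LiebTwo.ofFock A φ with hM
  have hMsupp := supp_ofFock_of_isInSector A hφ
  have hφM : φ = LiebTwo.toFock A M := (LiebTwo.toFock_ofFock A φ).symm
  have main := re_hsInner_liebOp_ge_of_block (liebHop_conjTranspose t w)
    (liebHop_apply_ne_zero t w) (liebOcc_conjTranspose v) (liebOcc_apply_ne_zero v) hU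
    (sq a) (sq (Fintype.card (PolySite Λ') - b)) hMsupp
  rw [hφM, key, nrm]
  rw [sub_mul] at main
  linarith

/-- **The half-filled block lemma (spin-reflection positivity for the certificate rows).** For the
Anderson cluster operator `h = andersonCluster Λ' t U w v` with `U ≥ 0` and site weights `v ≥ 0`
(any real `t`, any bond weights `w`): a lower bound `q ≤ E₀(h; N = |Λ'|)` on the HALF-FILLED
sector alone already gives `h - q·1 ⪰ 0` on the whole `4^{|Λ'|}`-dimensional Fock space, i.e.
`λ_min(h) = E₀(h; |Λ'|)`: the global minimum over all fillings and spins sits at half filling.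
This is Lieb's Theorem 2 mechanism (PRL 62 (1989) 1201) for the particle–hole symmetric weighted
cluster; it lets a certificate verify only the `N = |Λ'|` block (dimension `C(2|Λ'|, |Λ'|)`
instead of `4^{|Λ'|}`). [cite: LiebPRL1989, Theorem 2 and its proof] -/
theorem posSemidef_andersonCluster_sub_smul_of_le_groundEnergy (t : ℝ) {U : ℝ} (hU : 0 ≤ U)
    (w : Site d → Fin d → ℝ) {v : Site d → ℝ} (hv : ∀ x, 0 ≤ v x) {q : ℝ}
    (hq : q ≤ groundEnergy (andersonCluster Λ' t U w v) (Fintype.card (PolySite Λ'))) :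
    (andersonCluster Λ' t U w v - (q : ℂ) • (1 : FermionOp Λ')).PosSemidef :=
  posSemidef_sub_smul_one_of_forall_le_groundEnergy (andersonCluster_isHermitian Λ' t U w v)
    (andersonCluster_commute_totalNumber Λ' t U w v) fun _ hN =>
      le_groundEnergy_of_forall_isInSector _ (andersonCluster_isHermitian Λ' t U w v)
        (preservesSectors_andersonCluster Λ' t U w v) hN fun _ _ _ φ hφ =>
          andersonCluster_sector_bound Λ' t hU w hv hq φ hφ

/-- **Certificate form of the half-filled block lemma**: if the `N = |Λ'|` block
`B = h.toBlock (#s = |Λ'|) (#s = |Λ'|)` of the Anderson cluster operator (`U ≥ 0`, `v ≥ 0`)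
satisfies `B - q·1 ⪰ 0`, then `h - q·1 ⪰ 0` on the whole Fock space. This is the interface of the
`anderson_psd_*` rows: the PSD witness may be computed for the half-filled block only.
[cite: LiebPRL1989, Theorem 2 and its proof] -/
theorem posSemidef_andersonCluster_sub_smul_of_halfFilled_block (t : ℝ) {U : ℝ} (hU : 0 ≤ U)
    (w : Site d → Fin d → ℝ) {v : Site d → ℝ} (hv : ∀ x, 0 ≤ v x) {q : ℝ}
    (hblk : ((andersonCluster Λ' t U w v).toBlock
        (fun s => s.card = Fintype.card (PolySite Λ'))
        (fun s => s.card = Fintype.card (PolySite Λ')) -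
        (q : ℂ) • 1).PosSemidef) :
    (andersonCluster Λ' t U w v - (q : ℂ) • (1 : FermionOp Λ')).PosSemidef :=
  posSemidef_andersonCluster_sub_smul_of_le_groundEnergy Λ' t hU w hv
    (le_groundEnergy_of_sectorBlock_posSemidef _ (by rw [card_orb]; omega) hblk)

/-- **`SU(2)` refinement: one nearly balanced half-filled `(N↑, N↓)` sector suffices.** For
`a + b = |Λ'|` with `|a - b| ≤ 1` (e.g. `(9, 8)` on `17` sites), a lower bound
`q ≤ E(a, b) = sectorGroundEnergy h a b` gives `h - q·1 ⪰ 0` on the whole Fock space: `h` commutes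
with `Ŝ_±` (`andersonCluster_commute_spinPlus/Minus`), so the half-filled ground energy is attained
in the sector `(a, b)` (`sectorGroundEnergy_le_groundEnergy_of_su2`, Lieb's "every multiplet has a
representative at `S_z = 0` resp. `½`"), and the half-filled block lemma applies. Block dimension
`C(|Λ'|, a)·C(|Λ'|, b)` instead of `4^{|Λ'|}`. [cite: LiebPRL1989, proof of Theorems 1 and 2] -/
theorem posSemidef_andersonCluster_sub_smul_of_le_sectorGroundEnergy (t : ℝ) {U : ℝ} (hU : 0 ≤ U)
    (w : Site d → Fin d → ℝ) {v : Site d → ℝ} (hv : ∀ x, 0 ≤ v x) {a b : ℕ}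
    (hab : a + b = Fintype.card (PolySite Λ')) (ha : a ≤ b + 1) (hb : b ≤ a + 1) {q : ℝ}
    (hq : q ≤ sectorGroundEnergy (andersonCluster Λ' t U w v) a b) :
    (andersonCluster Λ' t U w v - (q : ℂ) • (1 : FermionOp Λ')).PosSemidef := by
  refine posSemidef_andersonCluster_sub_smul_of_le_groundEnergy Λ' t hU w hv (hq.trans ?_)
  rw [← hab]
  exact Summit.Ventures.CertifiedQuantumChemistry.sectorGroundEnergy_le_groundEnergy_of_su2
    (andersonCluster_isHermitian Λ' t U w v) (preservesSectors_andersonCluster Λ' t U w v)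
    (andersonCluster_commute_spinPlus Λ' t U w v) (andersonCluster_commute_spinMinus Λ' t U w v)
    (by omega) (by omega) ha hb

/-- **Certificate form of the `SU(2)` refinement**: if the `(N↑, N↓) = (a, b)` block of the Anderson
cluster operator (`a + b = |Λ'|`, `|a - b| ≤ 1`, `U ≥ 0`, `v ≥ 0`) satisfies `B - q·1 ⪰ 0`, then
`h - q·1 ⪰ 0` on the whole Fock space. [cite: LiebPRL1989, proof of Theorems 1 and 2] -/
theorem posSemidef_andersonCluster_sub_smul_of_sector_block (t : ℝ) {U : ℝ} (hU : 0 ≤ U)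
    (w : Site d → Fin d → ℝ) {v : Site d → ℝ} (hv : ∀ x, 0 ≤ v x) {a b : ℕ}
    (hab : a + b = Fintype.card (PolySite Λ')) (ha : a ≤ b + 1) (hb : b ≤ a + 1) {q : ℝ}
    (hblk : ((andersonCluster Λ' t U w v).toBlock
        (fun s => (upPart s).card = a ∧ (downPart s).card = b)
        (fun s => (upPart s).card = a ∧ (downPart s).card = b) - (q : ℂ) • 1).PosSemidef) :
    (andersonCluster Λ' t U w v - (q : ℂ) • (1 : FermionOp Λ')).PosSemidef :=
  posSemidef_andersonCluster_sub_smul_of_le_sectorGroundEnergy Λ' t hU w hv hab ha hb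
    (le_sectorGroundEnergy_of_toBlock_posSemidef (andersonCluster_isHermitian Λ' t U w v)
      (preservesSectors_andersonCluster Λ' t U w v) (by omega) (by omega) hblk)

/-- `|PolySite Λ'| = |Λ'|`, for stating the lemmas at `N = Λ'.card`. [folklore] -/
theorem card_polySite_eq (Λ' : Finset (Site d)) : Fintype.card (PolySite Λ') = Λ'.card :=
  ThermodynamicLimit.card_polySite Λ'

end Cluster

/-! ### The chain rows `andersonCluster (halfOpenBox 1 ℓ) t U (chainBondWeights w) …` -/

section Chain

/-- `|PolySite [0, ℓ)| = ℓ` for the chain cluster. [folklore] -/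
theorem card_polySite_halfOpenBox_one (ℓ : ℕ) : Fintype.card (PolySite (halfOpenBox 1 ℓ)) = ℓ := by
  rw [ThermodynamicLimit.card_polySite, card_halfOpenBox, pow_one]

/-- Entrywise nonnegative chain site weights are nonnegative. [folklore] -/
theorem chainSiteWeights_nonneg {v : ℕ → ℝ} (hv : ∀ j, 0 ≤ v j) (x : Site 1) :
    0 ≤ chainSiteWeights v x :=
  hv _

/-- **Chain rows, half-filled block**: for the weighted Anderson operator of the open chain cluster
`[0, ℓ)` (`U ≥ 0`, site weights `v j ≥ 0`), `PosSemidef` of the `N = ℓ` block of `h - q·1` gives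
`h - q·1 ⪰ 0` on the whole Fock space — the hypothesis shape of the `anderson_psd_chain_*` claim
nodes. [cite: LiebPRL1989, Theorem 2 and its proof] -/
theorem posSemidef_andersonChain_sub_smul_of_halfFilled_block (ℓ : ℕ) (t : ℝ) {U : ℝ}
    (hU : 0 ≤ U) (w : ℕ → ℝ) {v : ℕ → ℝ} (hv : ∀ j, 0 ≤ v j) {q : ℝ}
    (hblk : ((andersonCluster (halfOpenBox 1 ℓ) t U (chainBondWeights w)
        (chainSiteWeights v)).toBlock (fun s => s.card = ℓ) (fun s => s.card = ℓ) -
        (q : ℂ) • 1).PosSemidef) :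
    (andersonCluster (halfOpenBox 1 ℓ) t U (chainBondWeights w) (chainSiteWeights v) -
      (q : ℂ) • (1 : FermionOp (halfOpenBox 1 ℓ))).PosSemidef := by
  refine posSemidef_andersonCluster_sub_smul_of_halfFilled_block _ t hU _
    (chainSiteWeights_nonneg hv) ?_
  rw [card_polySite_halfOpenBox_one]
  exact hblk

/-- **Chain rows, one `(N↑, N↓)` block**: for the open chain cluster `[0, ℓ)` (`U ≥ 0`, `v j ≥ 0`),
`PosSemidef` of the `(a, b)` block of `h - q·1` with `a + b = ℓ`, `|a - b| ≤ 1` (e.g. `(9, 8)` at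
`ℓ = 17`) gives `h - q·1 ⪰ 0` on the whole Fock space.
[cite: LiebPRL1989, proof of Theorems 1 and 2] -/
theorem posSemidef_andersonChain_sub_smul_of_sector_block (ℓ : ℕ) (t : ℝ) {U : ℝ} (hU : 0 ≤ U)
    (w : ℕ → ℝ) {v : ℕ → ℝ} (hv : ∀ j, 0 ≤ v j) {a b : ℕ} (hab : a + b = ℓ) (ha : a ≤ b + 1)
    (hb : b ≤ a + 1) {q : ℝ}
    (hblk : ((andersonCluster (halfOpenBox 1 ℓ) t U (chainBondWeights w)
        (chainSiteWeights v)).toBlock (fun s => (upPart s).card = a ∧ (downPart s).card = b)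
        (fun s => (upPart s).card = a ∧ (downPart s).card = b) - (q : ℂ) • 1).PosSemidef) :
    (andersonCluster (halfOpenBox 1 ℓ) t U (chainBondWeights w) (chainSiteWeights v) -
      (q : ℂ) • (1 : FermionOp (halfOpenBox 1 ℓ))).PosSemidef :=
  posSemidef_andersonCluster_sub_smul_of_sector_block _ t hU _ (chainSiteWeights_nonneg hv)
    (hab.trans (card_polySite_halfOpenBox_one ℓ).symm) ha hb hblk

end Chain

end Summit.Ventures.CertifiedManyBodySolver.Rows
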